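import Summits.ResolutionOfSingularities.ResolutionOfSingularities.Theorems.FrobeniusClosingSteerLowTamingPrep
import HarnessLib

/-!
# Taming of the LOW tower: point stages are eventually NORMAL (D3c `LowTowerTamingTwo`, W4.1 — assembly)

W4.1, crux `Steer` (stmt-ResolutionOfSingularities-16345), σ-line at `p = 2`, LOW half. THE D3c PIECE of res-L0-w41-strat-2's
§σ2.24 (`LowTowerTamingTwo` over the interface `IsLowTowerTwo`, plan-1 RULING 41), for res-D-pv-012's concrete LOW tower, with the
interface clauses as separate hypotheses (the skeleton's `IsNormalIn` / `IsSingPrime` UNFOLDED; holder's leaf = `obtain` + `exact`).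

Proof (res-L0-w41-idea-3 card 3 v3, F5): a BAD curve at stage `n` is a prime `𝔮 ⊂ A n` (neither `⊥` nor `𝔪`) at which the torsor
`T² = h n` is singular and whose quotient `A n ⧸ 𝔮` is not regular. (i) Bad curves are FINITE (res-D-pv-007
`NormalStart.exists_derivation_apply_ne_zero` + `LowTaming.finite_setOf_singular`). (ii) Bad curves are NEVER CREATED: across a curve stage
(`A` fixed, `h n = x² h (n+1) + g²`) and across a point stage (`LowTamingStep`: the exceptional curve has a regular quotient, singularity
contracts, regular quotients persist) the bad set of stage `n+1` injects into that of stage `n` by contraction. (iii) The counts stabilise;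
were they eventually a positive constant, contraction would be bijective and a bad THREAD would exist, whose quotients
`LowTamingGerms.eventually_isRegularLocalRing_quotient_of_lineage` (engine `CurveLineage`, Kollár 1.101 ring level) makes regular:
contradiction. (iv) Hence from some stage on there is NO bad curve; at a POINT stage (T9) forbids singular curves with regular quotient too,
so `Y n = A n[T n]` is normal (`LowTaming.isIntegrallyClosed_closure_insert`) with fraction field `L` (T2): `IsNormalIn`.

No Theses file of W4.1 is imported; nothing here is a route item. OURS (the W4.1 engine), standard commutative algebra; NOT a statement
of the manuscript under review [claim: Hironaka2017, status: under-review]. [cite: Kollar2007, §1.4, Thm. 1.101] [cite: StacksProject, Tag 031S]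
[cite: Matsumura1987, Thm. 14.2] [folklore]
-/

noncomputable section

-- `Summit.<S>.<S>.…` duplicates the summit name by design (single-problem summit).
set_option linter.dupNamespace false

open Polynomial IsLocalRing Literature.AlgebraicGeometry.Resolution

namespace Summit.ResolutionOfSingularities.ResolutionOfSingularities.Theorems.SwitchingDichotomy.LowTaming

variable {L : Type} [Field L]

/-! ## §3 The taming theorem (D3c `LowTowerTamingTwo`, interface clauses unfolded) -/

/-- **D3c · Taming of the LOW tower.** For res-D-pv-012's LOW tower (clauses (T1), (T2), (T3), (T5), (T6), (T7), (T9) of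
res-L0-w41-strat-2's `IsLowTowerTwo`, given separately; `IsNormalIn` / `IsSingPrime` unfolded) with infinitely many point stages,
from some stage on every POINT stage has a NORMAL member: every `z ∈ L` satisfying a monic relation with coefficients in `Y n` lies in
`Y n`. See the module docstring for the proof. OURS. [cite: Kollar2007, §1.4, Thm. 1.101] [cite: StacksProject, Tag 031S]
[cite: Matsumura1987, Thm. 14.2] -/
theorem lowTowerTaming {k : Type} [Field k] [CharP k 2] [PerfectField k] [Algebra k L] [CharP L 2]
    (A Y : ℕ → Subalgebra k L) (h T x g : ℕ → L) (pt : Set ℕ)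
    (hAl : ∀ n, IsLocalRing (A n).toSubring)
    (hT1 : ∀ n, IsRegularLocalRing (A n).toSubring ∧ ringKrullDim (A n).toSubring = (2 : ℕ) ∧
      Algebra.EssFiniteType k (A n) ∧
      ∀ a : (A n).toSubring, ∃ b : (A n).toSubring, a - b ^ 2 ∈ @maximalIdeal _ _ (hAl n))
    (hT2 : ∀ n, h n ∈ A n ∧ T n ^ 2 = h n ∧
      (Y n).toSubring = Subring.closure (insert (T n) ((A n : Set L))) ∧
      IsLocalRing (Y n) ∧ Algebra.EssFiniteType k (Y n) ∧ IsFractionRing (Y n) L)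
    (hT3 : ∀ n, ∀ u v : L, u ∈ A n → v ∈ A n → v ≠ 0 → (u / v) ^ 2 ≠ h n)
    (hT5 : ∀ n, g n ∈ A n ∧ x n ≠ 0 ∧ (∃ hx : x n ∈ A n, (⟨x n, hx⟩ : (A n).toSubring) ∈ @maximalIdeal _ _ (hAl n)) ∧
      h (n + 1) * x n ^ 2 = h n - g n ^ 2 ∧ T (n + 1) * x n = T n - g n)
    (hT6 : ∀ n ∈ pt,
      @blowupRing _ _ (A n).toSubring (hAl n) (x n) ≤ (A (n + 1)).toSubring ∧
      (∀ z ∈ A (n + 1), ∃ a ∈ @blowupRing _ _ (A n).toSubring (hAl n) (x n),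
        ∃ b ∈ @blowupRing _ _ (A n).toSubring (hAl n) (x n), b⁻¹ ∈ A (n + 1) ∧ z = a / b) ∧
      SubringDominates (A n).toSubring (A (n + 1)).toSubring ∧
      IsQuadraticTransform (Y n).toSubring (Y (n + 1)).toSubring)
    (hT7 : ∀ n ∉ pt, A (n + 1) = A n)
    (hT9 : ∀ n ∈ pt, ∀ (Q : Ideal (A n).toSubring) [Q.IsPrime], Q ≠ ⊥ → Q ≠ @maximalIdeal _ _ (hAl n) →
      IsRegularLocalRing ((A n).toSubring ⧸ Q) →
      ∀ hh : h n ∈ A n, ¬ ¬ IsRegularLocalRing (AdjoinRoot ((X : (Localization.AtPrime Q)[X]) ^ 2 -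
        C (algebraMap (A n).toSubring (Localization.AtPrime Q) ⟨h n, hh⟩))))
    (hio : pt.Infinite) :
    ∃ n₀, ∀ n, n₀ ≤ n → n ∈ pt →
      ∀ z : L, (∃ q : L[X], q.Monic ∧ (∀ i, q.coeff i ∈ (Y n).toSubring) ∧ q.eval z = 0) → z ∈ (Y n).toSubring := by
  classical
  haveI : Fact (Nat.Prime 2) := ⟨Nat.prime_two⟩
  haveI hSl : ∀ n, IsLocalRing (A n).toSubring := hAl
  have hreg : ∀ n, IsRegularLocalRing (A n).toSubring := fun n => (hT1 n).1
  have hdim : ∀ n, ringKrullDim (A n).toSubring = (2 : ℕ) := fun n => (hT1 n).2.1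
  have hh : ∀ n, h n ∈ A n := fun n => (hT2 n).1
  have hle : ∀ n, (A n).toSubring ≤ (A (n + 1)).toSubring := fun n => by
    by_cases hn : n ∈ pt
    · exact (hT6 n hn).2.2.1.1
    · exact le_of_eq (congrArg Subalgebra.toSubring (hT7 n hn)).symm
  -- the bad curves at stage `n`
  set Bad : (n : ℕ) → Set (Ideal (A n).toSubring) := fun n =>
    {𝔮 | ∃ _ : 𝔮.IsPrime, 𝔮 ≠ ⊥ ∧ 𝔮 ≠ maximalIdeal (A n).toSubring ∧
      ¬ IsRegularLocalRing (AdjoinRoot ((X : (Localization.AtPrime 𝔮)[X]) ^ 2 -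
        C (algebraMap (A n).toSubring (Localization.AtPrime 𝔮) ⟨h n, hh n⟩))) ∧
      ¬ IsRegularLocalRing ((A n).toSubring ⧸ 𝔮)} with hBad
  /- (i) finiteness -/
  have hfin : ∀ n, (Bad n).Finite := by
    intro n
    haveI := hreg n
    haveI : IsIntegrallyClosed (A n) := isIntegrallyClosed_of_isRegularLocalRing (A n).toSubring
    haveI : Algebra.EssFiniteType k (A n) := (hT1 n).2.2.1
    have hf : ∀ c : A n, (⟨h n, hh n⟩ : A n) ≠ c ^ 2 := by
      intro c hc
      apply hT3 n c 1 c.2 (A n).one_mem one_ne_zero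
      rw [div_one]
      have h1 := congrArg Subtype.val hc
      simp only [SubmonoidClass.coe_pow] at h1
      exact h1.symm
    obtain ⟨D, hD⟩ := NormalStart.exists_derivation_apply_ne_zero k 2 (D := A n) hf
    exact (finite_setOf_singular (A n).toSubring (hdim n) ⟨h n, hh n⟩ D hD).subset
      fun 𝔮 ⟨hp, h0, hm, hs, _⟩ => ⟨hp, h0, hm, hs⟩
  /- (ii) the parent of a bad curve is bad; the parent map is injective -/
  have hstep : ∀ n, (∀ 𝔮' ∈ Bad (n + 1), 𝔮'.comap (Subring.inclusion (hle n)) ∈ Bad n) ∧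
      (∀ 𝔮₁ ∈ Bad (n + 1), ∀ 𝔮₂ ∈ Bad (n + 1),
        𝔮₁.comap (Subring.inclusion (hle n)) = 𝔮₂.comap (Subring.inclusion (hle n)) → 𝔮₁ = 𝔮₂) := by
    intro n
    haveI := hreg n
    haveI := hreg (n + 1)
    obtain ⟨hg, hx0, ⟨hxA, hxm⟩, hlaw, -⟩ := hT5 n
    by_cases hn : n ∈ pt
    · -- POINT stage: a quadratic transform in the chart `x n`
      obtain ⟨hB, hfrac, hdom, -⟩ := hT6 n hn
      have hqt : IsQuadraticTransform (A n).toSubring (A (n + 1)).toSubring :=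
        ⟨inferInstance, ⟨x n, hxA⟩, hxm, fun e => hx0 (congrArg Subtype.val e), inferInstance, hB, hfrac, hdom⟩
      -- a bad curve is off the exceptional one
      have hoff : ∀ 𝔮' ∈ Bad (n + 1),
          (∃ _ : 𝔮'.IsPrime, 𝔮'.comap (Subring.inclusion hqt.dominates.1) ≠ maximalIdeal (A n).toSubring) := by
        rintro 𝔮' ⟨hp', h0', hm', hs', hr'⟩
        refine ⟨hp', fun heq => hr' ?_⟩
        have hx𝔮 : (⟨x n, hdom.1 hxA⟩ : (A (n + 1)).toSubring) ∈ 𝔮' := by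
          have : (⟨x n, hxA⟩ : (A n).toSubring) ∈ 𝔮'.comap (Subring.inclusion hqt.dominates.1) := heq ▸ hxm
          exact this
        exact LowTamingStep.exceptional_quotient_isRegularLocalRing (hdim (n + 1)) hxA hxm hx0 hB hfrac hdom 𝔮' h0' hm' hx𝔮
      refine ⟨fun 𝔮' h𝔮' => ?_, fun 𝔮₁ h₁ 𝔮₂ h₂ heq => ?_⟩
      · obtain ⟨hp', hne⟩ := hoff 𝔮' h𝔮'
        obtain ⟨_, h0', hm', hs', hr'⟩ := h𝔮'
        refine ⟨Ideal.comap_isPrime _ _, ?_, hne, ?_, ?_⟩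
        · -- `≠ ⊥`
          intro hbot
          apply h0'
          refine (Submodule.eq_bot_iff _).mpr fun z hz => ?_
          obtain ⟨a, b, ha, hb, hbq, haq, hzb⟩ :=
            (BadCurveLineage.mem_iff_of_quadraticTransform hqt 𝔮' hne z.2).mp hz
          have ha0 : a = 0 := by
            have : (⟨a, ha⟩ : (A n).toSubring) ∈ (⊥ : Ideal (A n).toSubring) := hbot ▸ haq
            exact congrArg Subtype.val ((Submodule.mem_bot _).mp this)
          have hb0 : b ≠ 0 := by
            intro hb0
            apply hbq
            have : (⟨b, hqt.dominates.1 hb⟩ : (A (n + 1)).toSubring) = 0 := Subtype.ext hb0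
            rw [this]; exact Ideal.zero_mem _
          apply Subtype.ext
          have : (z : L) * b = 0 := by rw [hzb, ha0]
          exact (mul_eq_zero.mp this).resolve_right hb0
        · -- singular
          exact LowTamingStep.singular_comap_of_singular hqt hxA hx0 hB (f := ⟨h n, hh n⟩) (g := ⟨g n, hg⟩)
            (f' := ⟨h (n + 1), hh (n + 1)⟩) hlaw 𝔮' hne hs'
        · -- non-regular quotient
          intro hregq
          haveI := hregq
          haveI : IsDomain ((A n).toSubring ⧸ 𝔮'.comap (Subring.inclusion hqt.dominates.1)) :=
            (Ideal.Quotient.isDomain_iff_prime _).mpr inferInstance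
          have h0 : 𝔮'.comap (Subring.inclusion hqt.dominates.1) ≠ ⊥ := by
            intro hbot
            -- as above: `𝔮' = ⊥`
            apply h0'
            refine (Submodule.eq_bot_iff _).mpr fun z hz => ?_
            obtain ⟨a, b, ha, hb, hbq, haq, hzb⟩ :=
              (BadCurveLineage.mem_iff_of_quadraticTransform hqt 𝔮' hne z.2).mp hz
            have ha0 : a = 0 := by
              have : (⟨a, ha⟩ : (A n).toSubring) ∈ (⊥ : Ideal (A n).toSubring) := hbot ▸ haq
              exact congrArg Subtype.val ((Submodule.mem_bot _).mp this)
            have hb0 : b ≠ 0 := by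
              intro hb0
              apply hbq
              have : (⟨b, hqt.dominates.1 hb⟩ : (A (n + 1)).toSubring) = 0 := Subtype.ext hb0
              rw [this]; exact Ideal.zero_mem _
            apply Subtype.ext
            have : (z : L) * b = 0 := by rw [hzb, ha0]
            exact (mul_eq_zero.mp this).resolve_right hb0
          have hdvr := isDiscreteValuationRing_of_isRegularLocalRing_of_ringKrullDim_eq_one
            ((A n).toSubring ⧸ 𝔮'.comap (Subring.inclusion hqt.dominates.1))
            (ringKrullDim_quotient_eq_one (hdim n) _ h0 hne)
          exact hr' (LowTamingStep.isRegularLocalRing_quotient_of_comap hxA hxm hx0 hB hfrac hdom 𝔮' hne hdvr)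
      · obtain ⟨hp₁, hne₁⟩ := hoff 𝔮₁ h₁
        obtain ⟨hp₂, -⟩ := hoff 𝔮₂ h₂
        exact BadCurveLineage.eq_of_comap_eq_of_quadraticTransform hqt 𝔮₁ 𝔮₂ hne₁ heq
    · -- CURVE stage: `A (n+1) = A n`, radicand law `h n = x² h(n+1) + g²`
      have hAA : A (n + 1) = A n := hT7 n hn
      have hSS : (A (n + 1)).toSubring = (A n).toSubring := congrArg Subalgebra.toSubring hAA
      have key : ∀ (S' : Subring L) (hS' : S' = (A n).toSubring) [IsRegularLocalRing S'] (f' : S')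
          (hf' : (f' : L) * x n ^ 2 = h n - g n ^ 2) (𝔮' : Ideal S') [𝔮'.IsPrime],
          𝔮' ≠ ⊥ → 𝔮' ≠ maximalIdeal S' →
          ¬ IsRegularLocalRing (AdjoinRoot ((X : (Localization.AtPrime 𝔮')[X]) ^ 2 -
            C (algebraMap S' (Localization.AtPrime 𝔮') f'))) →
          ¬ IsRegularLocalRing (S' ⧸ 𝔮') →
          𝔮'.comap (Subring.inclusion hS'.ge) ∈ Bad n ∧
            ∀ (𝔮₂ : Ideal S'), 𝔮'.comap (Subring.inclusion hS'.ge) = 𝔮₂.comap (Subring.inclusion hS'.ge) →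
              𝔮' = 𝔮₂ := by
        intro S' hS' _ f' hf' 𝔮' _ h0' hm' hs' hr'
        subst hS'
        have hid : ∀ 𝔮₂ : Ideal (A n).toSubring, 𝔮₂.comap (Subring.inclusion (le_refl _)) = 𝔮₂ := by
          intro 𝔮₂; ext z; rw [Ideal.mem_comap]; exact Iff.of_eq (congrArg (· ∈ 𝔮₂) (Subtype.ext rfl))
        refine ⟨?_, fun 𝔮₂ heq => by rwa [hid, hid] at heq⟩
        rw [hid]
        refine ⟨‹_›, h0', hm', ?_, hr'⟩
        -- singularity for `h n` from singularity for `h (n+1)` along the curve-step law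
        haveI : IsRegularLocalRing (Localization.AtPrime 𝔮') := isRegularLocalRing_localization_atPrime _ 𝔮'
        haveI : CharP (Localization.AtPrime 𝔮') 2 := RadicandLocalization.charP_localization_atPrime 2 𝔮'
        intro hregular
        apply hs'
        by_contra hsing
        obtain ⟨γ, hγ⟩ := (RadicandSingular.not_isRegularLocalRing_adjoinRoot_atPrime_iff 2 𝔮' f').mp hsing
        have hlaw' : algebraMap (A n).toSubring (Localization.AtPrime 𝔮') ⟨h n, hh n⟩ =
            algebraMap _ _ (⟨x n, hxA⟩ : (A n).toSubring) ^ 2 * algebraMap _ _ f' +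
              algebraMap _ _ (⟨g n, hg⟩ : (A n).toSubring) ^ 2 := by
          rw [← map_pow, ← map_mul, ← map_pow, ← map_add]
          congr 1
          apply Subtype.ext
          change h n = x n ^ 2 * (f' : L) + g n ^ 2
          linear_combination -hf'
        have := BadCurveStep.sub_sq_mem_of_curveStep (maximalIdeal (Localization.AtPrime 𝔮') ^ 2) hlaw' hγ
        exact ((RadicandSingular.not_isRegularLocalRing_adjoinRoot_atPrime_iff 2 𝔮' ⟨h n, hh n⟩).mpr ⟨_, this⟩) hregular
      have hle' : Subring.inclusion (hle n) = Subring.inclusion hSS.ge := rfl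
      refine ⟨fun 𝔮' h𝔮' => ?_, fun 𝔮₁ h₁ 𝔮₂ h₂ heq => ?_⟩
      · obtain ⟨hp', h0', hm', hs', hr'⟩ := h𝔮'
        exact (key (A (n + 1)).toSubring hSS ⟨h (n + 1), hh (n + 1)⟩ hlaw 𝔮' h0' hm' hs' hr').1
      · obtain ⟨hp', h0', hm', hs', hr'⟩ := h₁
        obtain ⟨hp₂, -⟩ := h₂
        exact (key (A (n + 1)).toSubring hSS ⟨h (n + 1), hh (n + 1)⟩ hlaw 𝔮₁ h0' hm' hs' hr').2 𝔮₂ heq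
  /- (iii) the counts stabilise; a persistent bad thread is impossible -/
  set c : ℕ → ℕ := fun n => (Bad n).ncard with hc
  have hcle : ∀ n, c (n + 1) ≤ c n := fun n =>
    Set.ncard_le_ncard_of_injOn (fun 𝔮' => 𝔮'.comap (Subring.inclusion (hle n))) (hstep n).1
      (fun 𝔮₁ h₁ 𝔮₂ h₂ heq => (hstep n).2 𝔮₁ h₁ 𝔮₂ h₂ heq) (hfin n)
  have hcanti : Antitone c := antitone_nat_of_succ_le hcle
  obtain ⟨N, hN⟩ : ∃ N, ∀ n, N ≤ n → c n = c N := by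
    by_contra hcon
    push Not at hcon
    have key : ∀ m : ℕ, ∃ n, c n + m ≤ c 0 := by
      intro m
      induction m with
      | zero => exact ⟨0, by simp⟩
      | succ m ih =>
        obtain ⟨n, hn⟩ := ih
        obtain ⟨n', hnn', hne⟩ := hcon n
        have h1 : c n' < c n := lt_of_le_of_ne (hcanti hnn') hne
        exact ⟨n', by omega⟩
    obtain ⟨n, hn⟩ := key (c 0 + 1)
    omega
  have hempty : c N = 0 := by
    by_contra hpos
    -- parent maps are bijections from `N` on: build a thread of bad curves
    have hsurj : ∀ n, N ≤ n → ∀ 𝔮 ∈ Bad n, ∃ 𝔮' ∈ Bad (n + 1), 𝔮'.comap (Subring.inclusion (hle n)) = 𝔮 := by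
      intro n hn 𝔮 h𝔮
      have hcard : (Bad n).ncard ≤ (Bad (n + 1)).ncard := by
        change c n ≤ c (n + 1); rw [hN n hn, hN (n + 1) (Nat.le_succ_of_le hn)]
      obtain ⟨𝔮', h𝔮', heq⟩ := Set.surj_on_of_inj_on_of_ncard_le (s := Bad (n + 1)) (t := Bad n)
        (fun 𝔮' _ => 𝔮'.comap (Subring.inclusion (hle n))) (fun 𝔮' h' => (hstep n).1 𝔮' h')
        (fun 𝔮₁ 𝔮₂ h₁ h₂ heq => (hstep n).2 𝔮₁ h₁ 𝔮₂ h₂ heq) hcard (hfin n) 𝔮 h𝔮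
      exact ⟨𝔮', h𝔮', heq.symm⟩
    have hne0 : (Bad N).Nonempty := Set.nonempty_of_ncard_ne_zero hpos
    obtain ⟨𝔮N, h𝔮N⟩ := hne0
    -- the thread
    have thread : ∃ β : (m : ℕ) → Ideal (A (N + m)).toSubring,
        (∀ m, β m ∈ Bad (N + m)) ∧ ∀ m, (β (m + 1)).comap (Subring.inclusion (hle (N + m))) = β m := by
      let next : (m : ℕ) → {𝔮 : Ideal (A (N + m)).toSubring // 𝔮 ∈ Bad (N + m)} →
          {𝔮 : Ideal (A (N + (m + 1))).toSubring // 𝔮 ∈ Bad (N + (m + 1))} := fun m 𝔮 =>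
        ⟨Classical.choose (hsurj (N + m) (Nat.le_add_right N m) 𝔮.1 𝔮.2),
          (Classical.choose_spec (hsurj (N + m) (Nat.le_add_right N m) 𝔮.1 𝔮.2)).1⟩
      let β : (m : ℕ) → {𝔮 : Ideal (A (N + m)).toSubring // 𝔮 ∈ Bad (N + m)} :=
        fun m => Nat.rec (motive := fun m => {𝔮 : Ideal (A (N + m)).toSubring // 𝔮 ∈ Bad (N + m)})
          ⟨𝔮N, h𝔮N⟩ (fun m 𝔮 => next m 𝔮) m
      refine ⟨fun m => (β m).1, fun m => (β m).2, fun m => ?_⟩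
      exact (Classical.choose_spec (hsurj (N + m) (Nat.le_add_right N m) (β m).1 (β m).2)).2
    obtain ⟨β, hβ, hβc⟩ := thread
    -- the lineage theorem along the thread
    haveI hβp : ∀ m, (β m).IsPrime := fun m => (hβ m).1
    have hβne : ∀ m, β m ≠ maximalIdeal _ := fun m => (hβ m).2.2.1
    have hβ0 : ∀ m, β m ≠ ⊥ := fun m => (hβ m).2.1
    haveI : IsDomain ((A (N + 0)).toSubring ⧸ β 0) := (Ideal.Quotient.isDomain_iff_prime _).mpr (hβp 0)
    haveI : Nontrivial ((A (N + 0)).toSubring ⧸ β 0) := Ideal.Quotient.nontrivial_iff.mpr (hβp 0).ne_top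
    have hlocq : IsLocalRing ((A (N + 0)).toSubring ⧸ β 0) :=
      IsLocalRing.of_surjective' (Ideal.Quotient.mk (β 0)) Ideal.Quotient.mk_surjective
    have hNq : IsNoetherianRing ((A (N + 0)).toSubring ⧸ β 0) := by
      haveI := hreg (N + 0); infer_instance
    have hdimq : ringKrullDim ((A (N + 0)).toSubring ⧸ β 0) = 1 := by
      haveI := hreg (N + 0); exact ringKrullDim_quotient_eq_one (hdim (N + 0)) _ (hβ0 0) (hβne 0)
    have hfinq := by
      haveI := hreg (N + 0)
      exact module_finite_integralClosure_quotient (A (N + 0)) (hdim (N + 0)) (hT1 (N + 0)).2.2.1 (β 0) (hβ0 0) (hβne 0)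
    have hinf' : {m : ℕ | N + m ∈ pt}.Infinite := by
      refine Set.infinite_of_forall_exists_gt fun m => ?_
      obtain ⟨n, hn, hlt⟩ := hio.exists_gt (N + m)
      refine ⟨n - N, ?_, by omega⟩
      change N + (n - N) ∈ pt
      rwa [Nat.add_sub_cancel' (by omega)]
    obtain ⟨m₀, hm₀⟩ := LowTamingGerms.eventually_isRegularLocalRing_quotient_of_lineage
      (fun m => (A (N + m)).toSubring) (fun m => by haveI := hreg (N + m); infer_instance)
      (fun m => x (N + m)) {m | N + m ∈ pt}
      (fun m => by
        obtain ⟨-, hx0, ⟨hxA, hxm⟩, -⟩ := hT5 (N + m)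
        exact ⟨hxA, hx0, hxm⟩)
      (fun m hm => by
        obtain ⟨hB, hfrac, hdom, -⟩ := hT6 (N + m) hm
        exact ⟨hB, hfrac, hdom⟩)
      (fun m hm => congrArg Subalgebra.toSubring (hT7 (N + m) hm))
      (fun m => hle (N + m)) β hβc hβne hlocq hNq hdimq hfinq hinf'
    exact (hβ m₀).2.2.2.2 (hm₀ m₀ le_rfl)
  /- (iv) from `N` on there is no bad curve; at point stages the member is normal -/
  refine ⟨N, fun n hn hnpt z hz => ?_⟩
  have hBadn : Bad n = ∅ := by
    have : (Bad n).ncard = 0 := by change c n = 0; rw [hN n hn, hempty]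
    exact (Set.ncard_eq_zero (hfin n)).mp this
  haveI := hreg n
  obtain ⟨_, hTn, hYn, -, -, hfracY⟩ := hT2 n
  have hnr : ∀ u v : (A n).toSubring, (v : L) ≠ 0 → ((u : L) / (v : L)) ^ 2 ≠ h n :=
    fun u v hv => hT3 n u v u.2 v.2 hv
  have hcurves : ∀ (𝔮 : Ideal (A n).toSubring) [𝔮.IsPrime], 𝔮.height = 1 →
      IsRegularLocalRing (AdjoinRoot ((X : (Localization.AtPrime 𝔮)[X]) ^ 2 -
        C (algebraMap (A n).toSubring (Localization.AtPrime 𝔮) ⟨h n, hh n⟩))) := by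
    intro 𝔮 _ h1
    haveI := isDomain_of_isRegularLocalRing (A n).toSubring
    have h0 : 𝔮 ≠ ⊥ := Ideal.ne_bot_of_height_eq_one h1
    have hm : 𝔮 ≠ maximalIdeal (A n).toSubring := by
      intro heq
      have h2 := IsLocalRing.maximalIdeal_height_eq_ringKrullDim (R := (A n).toSubring)
      rw [← heq, h1, hdim n, ← WithBot.coe_natCast] at h2
      have h3 : (1 : ℕ∞) = ((2 : ℕ) : ℕ∞) := WithBot.coe_eq_coe.mp h2
      norm_num at h3
    by_contra hs
    by_cases hregq : IsRegularLocalRing ((A n).toSubring ⧸ 𝔮)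
    · exact (hT9 n hnpt 𝔮 h0 hm hregq (hh n)) hs
    · have : 𝔮 ∈ Bad n := ⟨‹_›, h0, hm, hs, hregq⟩
      rw [hBadn] at this
      exact this
  haveI hIC : IsIntegrallyClosed (Subring.closure (insert (T n) ((A n : Set L)))) :=
    isIntegrallyClosed_closure_insert (A n).toSubring (hdim n) (hh n) hTn hnr hcurves
  haveI : IsIntegrallyClosed (Y n).toSubring := by rw [hYn]; exact hIC
  haveI : IsFractionRing (Y n).toSubring L := hfracY
  exact mem_of_monic_relation (Y n).toSubring z hz

end Summit.ResolutionOfSingularities.ResolutionOfSingularities.Theorems.SwitchingDichotomy.LowTaming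

end
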